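import Literature.NumberTheory.GaloisRepresentations.GalLayerSystem
import Literature.Algebra.Homology.CoinducedConjugation
import HarnessLib

/-!
# Layers of the limit of a Galois layer system: `(lim S)^{Gal(F̄/E)} ≅ S.obj E` as representations,
# `Hⁿ(Γ_F ⧸ U_E, (lim S)^{U_E}) ≅ Hⁿ(Gal(E/F), S.obj E)`, and door-c4's transitions are the inflations
# (Serre, *Galois Cohomology* I §2.2 Prop. 8; Tate, C–F VII §11.1; Harari §13.1)

Topic `NumberTheory/GaloisRepresentations`; namespaces `Literature.NumberTheory.GaloisRepresentations.GalLayerData`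
(structure `GalLayerData`) and `IdeleClassBar.GalLayer` (auxiliary statements).  Sequel to `GalLayerSystem.lean` (door-c5 g16: `GalLayerSystem F`,
`S.limit`, `S.of`, `S.rep`, `S.toD : DiscreteRepCat ℤ Γ_F`, `S.setOf_forall_mem_eq_range`) and the generic form of
`IdeleClassGroupLimitLayers.lean` / `IdeleClassGroupLimitInflation.lean` (the case `S = C`).  Definitions with bodies and
theorems; NO named fact, no `sorry`, no instance, no notation.  Route A of crux `AnticycControlAdditiveK` (item 19295).

Design (Lean).  The layer constructions need `ℤ`-LINEAR maps on the layer modules (Mathlib's `groupCohomology.mapIso`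
takes a `LinearEquiv`, `Rep` morphisms are intertwining LINEAR maps), and for an abstract `S : GalLayerSystem F` the module
structure `(S.obj E).hV2` carried by the `Rep` object is not definitionally the canonical `ℤ`-module structure that instance
resolution produces — so this file works with systems GIVEN BY DATA `D : GalLayerData F` (a bundled abelian group
`D.V E : AddCommGrpCat` with a `Representation` for each layer, base changes as additive maps; `D.toSystem : GalLayerSystem F`
with `obj E = Rep.of (D.ρ E)`), for which the two structures agree by construction.  The three systems of the idèle class formation are given by such data.

Mathematics.  For a Galois layer system `S = D.toSystem` over a number field `F` and a layer `E` with `U_E = Gal(F̄/E)`, the layer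
`(lim S)^{U_E}` of door-c4's system (`(DiscreteRep.invariantsQuotFunctor ℤ U_E).obj S.toD : Rep ℤ (Γ_F ⧸ U_E)`) is `S.obj E`
(`H⁰(Gal(F̄/E), lim S) = S.obj E`), equivariantly along `Γ_F ⧸ U_E ≃* Gal(E/F)`; hence
`Hⁿ(Γ_F ⧸ U_E, (lim S)^{U_E}) ≅ Hⁿ(Gal(E/F), S.obj E)` (Mathlib `groupCohomology.mapIso`), and for `E ≤ E'` door-c4's
transition `Hⁿ(quotMap, incl)` corresponds to the INFLATION `S.inf h n = Hⁿ(res_{E'/E}, S.base h)` of the system (Serre I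
§2.2 Prop. 8: `Hq(G, A) = lim→ Hq(G/U, A^U)` along the inflations).  Since `S.base` is the identity at `E = E`
(`base_self`), `S.inf` is the identity there (`inf_self`) and everything is uniform in `E ≤ E'`.

## What is formalised (`F : Type` a number field, `Γ = absoluteGaloisGroup F`, `D : GalLayerData F`, `S = D.toSystem`)

* §4 `GalLayer.resHom h : Gal(E'/F) →* Gal(E/F)` (`E ≤ E'`; `resHom_restrictHom`, `resHom_surjective`, `resHom_self`,
  `quotMap_comp_quotEquiv_symm_eq`); the structure **`GalLayerData F`**, `D.obj E = Rep.of (D.ρ E)`,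
  **`D.toSystem : GalLayerSystem F`**.
* §5 the layer: `D.layerRep E` (door-c4's object), `coe_layerRep_ρ_mk`, `mem_invariants_iff`, `toInvariantsHom` (+
  `_bijective`), **`D.layerEquiv E : (D.layerRep E).V ≃ₗ[ℤ] D.V E`** (+ `layerEquiv_symm_apply`, `coe_layerEquiv_symm`,
  `of_layerEquiv`, `layerEquiv_eq_iff`, `layerEquiv_ρ_mk`, **`layerEquiv_comm`**, **`layerEquiv_invariantsStepIncl`**),
  **`D.layerCohomologyIso E n : Hⁿ(Γ ⧸ U_E, (lim S)^{U_E}) ≅ Hⁿ(Gal(E/F), D.obj E)`**.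
* §6 inflation: **`D.baseRepHom h : Res_{res} (D.obj E) ⟶ D.obj E'`**, **`D.inf h n`** (+ `inf_self`),
  **`map_invariantsStepIncl_comp_layerCohomologyIso`** (`Hⁿ(quotMap, incl) ≫ iso_{E'} = iso_E ≫ D.inf h n`).

## References
* J.-P. Serre, *Galois Cohomology*, Springer (1997), I §2.2 Proposition 8. [SerreGaloisCohomology1997]
* J. W. S. Cassels, A. Fröhlich (eds.), *Algebraic Number Theory* (1967), Ch. VII (J. Tate) §11.1. [CasselsFrohlichANT1967]
* D. Harari, *Galois Cohomology and Class Field Theory* (2020), §13.1. [Harari2020]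
-/

noncomputable section

open CategoryTheory groupCohomology
open Field (absoluteGaloisGroup)
open Literature.Algebra.Homology
open scoped Classical

namespace Literature.NumberTheory.GaloisRepresentations

namespace IdeleClassBar

namespace GalLayer

variable {F : Type} [Field F]

/-! ## §4. `Gal(E'/F) → Gal(E/F)` for `E ≤ E'` -/

/-- **`res : Gal(E'/F) → Gal(E/F)`, `τ ↦ τ|_E`** for layers `E ≤ E'` (Mathlib `AlgEquiv.restrictNormalHom` along the
inclusion algebra `algebraOfLE h`). [cite: SerreGaloisCohomology1997, I §2.2] -/
def resHom {E E' : GalLayer F} (h : E ≤ E') : (E'.1 ≃ₐ[F] E'.1) →* (E.1 ≃ₐ[F] E.1) :=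
  haveI := E.isGalois
  letI := algebraOfLE h
  haveI := isScalarTower_of_le h
  AlgEquiv.restrictNormalHom E.1

/-- `res (σ|_{E'}) = σ|_E`. [cite: SerreGaloisCohomology1997, I §2.2] -/
theorem resHom_restrictHom {E E' : GalLayer F} (h : E ≤ E') (σ : absoluteGaloisGroup F) :
    resHom h (E'.restrictHom σ) = E.restrictHom σ :=
  restrictHom_restrictHom h σ

/-- `res ∘ (σ ↦ σ|_{E'}) = (σ ↦ σ|_E)`. [cite: SerreGaloisCohomology1997, I §2.2] -/
theorem resHom_comp_restrictHom {E E' : GalLayer F} (h : E ≤ E') : (resHom h).comp E'.restrictHom = E.restrictHom :=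
  MonoidHom.ext (resHom_restrictHom h)

/-- `res : Gal(E'/F) → Gal(E/F)` is onto. [cite: SerreGaloisCohomology1997, I §2.2] -/
theorem resHom_surjective {E E' : GalLayer F} (h : E ≤ E') : Function.Surjective (resHom h) := fun τ => by
  obtain ⟨σ, rfl⟩ := E.restrictHom_surjective τ
  exact ⟨E'.restrictHom σ, resHom_restrictHom h σ⟩

/-- At `E = E`, `res` is the identity. [cite: SerreGaloisCohomology1997, I §2.2] -/
theorem resHom_self {E : GalLayer F} (h : E ≤ E) (τ : E.1 ≃ₐ[F] E.1) : resHom h τ = τ := by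
  obtain ⟨σ, rfl⟩ := E.restrictHom_surjective τ
  exact resHom_restrictHom h σ

/-- `quotMap_{U_E U_{E'}} ∘ quotEquiv_{E'}⁻¹ = quotEquiv_E⁻¹ ∘ res` as homomorphisms `Gal(E'/F) → Γ_F ⧸ U_E` (both send
`σ|_{E'}` to `[σ]`). [cite: SerreGaloisCohomology1997, I §2.2 Proposition 8] -/
theorem quotMap_comp_quotEquiv_symm_eq [NumberField F] {E E' : GalLayer F} (h : E ≤ E') :
    (DiscreteRep.quotMap (E.openNormalSubgroup : Subgroup (absoluteGaloisGroup F))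
          (E'.openNormalSubgroup : Subgroup (absoluteGaloisGroup F)) (coe_openNormalSubgroup_le h)).comp
        E'.quotEquiv.symm.toMonoidHom =
      E.quotEquiv.symm.toMonoidHom.comp (resHom h) := by
  refine MonoidHom.ext fun τ => ?_
  obtain ⟨σ, rfl⟩ := E'.restrictHom_surjective τ
  change DiscreteRep.quotMap _ _ (coe_openNormalSubgroup_le h) (E'.quotEquiv.symm (E'.restrictHom σ)) =
    E.quotEquiv.symm (resHom h (E'.restrictHom σ))
  rw [quotEquiv_symm_restrictHom, resHom_restrictHom, quotEquiv_symm_restrictHom]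
  rfl

end GalLayer

end IdeleClassBar

open IdeleClassBar

/-! ### Systems given by data: an abelian group with a `Representation` per layer -/

/-- **A Galois layer system given by data**: for each layer an abelian group `D.V E` (bundled) with a `ℤ`-linear
representation `D.ρ E` of `Gal(E/F)` (for the canonical `ℤ`-module structure), base changes as additive maps, with the
axioms of `GalLayerSystem` (`D.toSystem`).  [cite: CasselsFrohlichANT1967, Ch. VII §8 Prop. 8.1 and §9.7] -/
structure GalLayerData (F : Type) [Field F] where
  /-- The abelian group of the layer (bundled, Mathlib `AddCommGrpCat`; used through its coercion to `Type`). -/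
  V : GalLayer F → AddCommGrpCat.{0}
  /-- The action of `Gal(E/F)`. -/
  ρ (E : GalLayer F) : Representation ℤ (E.1 ≃ₐ[F] E.1) (V E)
  /-- The base change `D.V E → D.V E'` for `E ≤ E'`. -/
  base ⦃E E' : GalLayer F⦄ (h : E ≤ E') : V E →+ V E'
  /-- Base changes compose. -/
  base_base ⦃E E' E'' : GalLayer F⦄ (h : E ≤ E') (h' : E' ≤ E'') (x : V E) :
    base h' (base h x) = base (h.trans h') x
  /-- Base changes are injective. -/
  base_injective ⦃E E' : GalLayer F⦄ (h : E ≤ E') : Function.Injective (base h)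
  /-- Base changes are `Γ_F`-equivariant. -/
  base_ρ ⦃E E' : GalLayer F⦄ (h : E ≤ E') (σ : absoluteGaloisGroup F) (x : V E) :
    base h (ρ E (E.restrictHom σ) x) = ρ E' (E'.restrictHom σ) (base h x)
  /-- Galois descent. -/
  descent ⦃E M : GalLayer F⦄ (h : E ≤ M) (y : V M)
    (hy : ∀ σ ∈ E.openNormalSubgroup, ρ M (M.restrictHom σ) y = y) : ∃ x : V E, base h x = y

namespace GalLayerData

variable {F : Type} [Field F] (D : GalLayerData F)

/-- The layer module as an object of `Rep ℤ Gal(E/F)`. [cite: CasselsFrohlichANT1967, Ch. VII §8] -/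
abbrev obj (E : GalLayer F) : Rep.{0} ℤ (E.1 ≃ₐ[F] E.1) := Rep.of (D.ρ E)

/-- **The Galois layer system of the data.** [cite: CasselsFrohlichANT1967, Ch. VII §9.7] -/
abbrev toSystem : GalLayerSystem F where
  obj := D.obj
  base := D.base
  base_base := D.base_base
  base_injective := D.base_injective
  base_ρ := D.base_ρ
  descent := D.descent

/-- `D.toSystem.obj E = D.obj E`. [cite: CasselsFrohlichANT1967, Ch. VII §9.7] -/
theorem toSystem_obj (E : GalLayer F) : D.toSystem.obj E = D.obj E := rfl

/-- `D.toSystem.base = D.base`. [cite: CasselsFrohlichANT1967, Ch. VII §9.7] -/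
theorem toSystem_base {E E' : GalLayer F} (h : E ≤ E') (x : D.V E) : D.toSystem.base h x = D.base h x := rfl

variable [NumberField F]

/-! ## §5. The layer `(lim S)^{U_E} ≅ D.obj E` and its cohomology -/

/-- **The layer object `(lim S)^{U_E}` of door-c4's system** (`(invariantsQuotFunctor ℤ U_E).obj S.toD`, a representation of
`Γ_F ⧸ U_E`; an abbreviation, so that door-c4's `LExt`, `invariantsStepIncl`, `step` apply verbatim).
[cite: SerreGaloisCohomology1997, I §2.2 Proposition 8] -/
abbrev layerRep (E : GalLayer F) :
    Rep ℤ (absoluteGaloisGroup F ⧸ (E.openNormalSubgroup : Subgroup (absoluteGaloisGroup F))) :=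
  (DiscreteRep.invariantsQuotFunctor ℤ (E.openNormalSubgroup : Subgroup (absoluteGaloisGroup F))).obj D.toSystem.toD

omit [NumberField F] in
/-- The underlying vector of `[σ] • z` in the layer is `σ • z`. [cite: Harari2020, §13.1] -/
theorem coe_layerRep_ρ_mk (E : GalLayer F) (σ : absoluteGaloisGroup F) (z : (D.layerRep E).V) :
    (((D.layerRep E).ρ (QuotientGroup.mk σ) z).1 : D.toSystem.limit) = D.toSystem.rep σ (z.1 : D.toSystem.limit) := rfl

omit [NumberField F] in
/-- **`(lim S)^{U_E}` is the image of `D.obj E`** (in `Representation.invariants` form). [cite: Harari2020, §13.1] -/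
theorem mem_invariants_iff (E : GalLayer F) (z : D.toSystem.limit) :
    z ∈ Representation.invariants
        (D.toSystem.toRep.ρ.comp (E.openNormalSubgroup : Subgroup (absoluteGaloisGroup F)).subtype) ↔
      z ∈ Set.range (D.toSystem.of E) := by
  rw [← GalLayerSystem.setOf_forall_mem_eq_range, Representation.mem_invariants, Set.mem_setOf_eq]
  constructor
  · intro h σ hσ
    exact h ⟨σ, hσ⟩
  · intro h g
    exact h g.1 g.2

/-- `D.obj E → (lim S)^{U_E}`, `x ↦ [x]`. [cite: Harari2020, §13.1] -/
def toInvariantsHom (E : GalLayer F) : D.V E →+ (D.layerRep E).V :=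
  AddMonoidHom.mk' (fun x => ⟨D.toSystem.of E x, (D.mem_invariants_iff E _).2 ⟨x, rfl⟩⟩) fun x y =>
    Subtype.ext (map_add (D.toSystem.of E) x y)

omit [NumberField F] in
/-- Formula. [cite: Harari2020, §13.1] -/
theorem coe_toInvariantsHom (E : GalLayer F) (x : D.V E) :
    ((D.toInvariantsHom E x).1 : D.toSystem.limit) = D.toSystem.of E x := rfl

omit [NumberField F] in
/-- `D.obj E → (lim S)^{U_E}` is bijective. [cite: Harari2020, §13.1] -/
theorem toInvariantsHom_bijective (E : GalLayer F) : Function.Bijective (D.toInvariantsHom E) := by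
  refine ⟨fun x y hxy => D.toSystem.of_injective E (congrArg Subtype.val hxy), fun z => ?_⟩
  obtain ⟨x, hx⟩ := (D.mem_invariants_iff E z.1).1 z.2
  exact ⟨x, Subtype.ext hx⟩

/-- **The layer module: `(lim S)^{U_E} ≃ₗ[ℤ] D.V E`** (inverse of `x ↦ [x]`). [cite: Harari2020, §13.1] -/
def layerEquiv (E : GalLayer F) :
    letI := (D.layerRep E).hV2
    (D.layerRep E).V ≃ₗ[ℤ] D.V E :=
  { (AddEquiv.ofBijective (D.toInvariantsHom E) (D.toInvariantsHom_bijective E)).symm with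
    map_smul' := fun c z => by
      let e := (AddEquiv.ofBijective (D.toInvariantsHom E) (D.toInvariantsHom_bijective E)).symm
      change e (c • z) = c • e z
      induction c using Int.induction_on with
      | zero => rw [zero_smul, zero_smul, map_zero]
      | succ n ih => rw [add_smul, add_smul, one_smul, one_smul, map_add, ih]
      | pred n ih => rw [sub_smul, sub_smul, one_smul, one_smul, map_sub, ih] }

omit [NumberField F] in
/-- `layerEquiv⁻¹ x = [x]`. [cite: Harari2020, §13.1] -/
theorem layerEquiv_symm_apply (E : GalLayer F) (x : D.V E) :
    (D.layerEquiv E).symm x = D.toInvariantsHom E x :=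
  (D.layerEquiv E).symm_apply_eq.2
    (((AddEquiv.ofBijective (D.toInvariantsHom E) (D.toInvariantsHom_bijective E)).symm_apply_apply x).symm.trans
      rfl)

omit [NumberField F] in
/-- `layerEquiv⁻¹ x = [x]` on underlying vectors. [cite: Harari2020, §13.1] -/
theorem coe_layerEquiv_symm (E : GalLayer F) (x : D.V E) :
    (((D.layerEquiv E).symm x).1 : D.toSystem.limit) = D.toSystem.of E x := by
  rw [layerEquiv_symm_apply, coe_toInvariantsHom]

omit [NumberField F] in
/-- `[layerEquiv z] = z`. [cite: Harari2020, §13.1] -/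
theorem of_layerEquiv (E : GalLayer F) (z : (D.layerRep E).V) :
    D.toSystem.of E (D.layerEquiv E z) = (z.1 : D.toSystem.limit) := by
  rw [← coe_layerEquiv_symm, LinearEquiv.symm_apply_apply]

omit [NumberField F] in
/-- `layerEquiv z = x ↔ z = [x]`. [cite: Harari2020, §13.1] -/
theorem layerEquiv_eq_iff (E : GalLayer F) (z : (D.layerRep E).V) (x : D.V E) :
    D.layerEquiv E z = x ↔ (z.1 : D.toSystem.limit) = D.toSystem.of E x := by
  constructor
  · rintro rfl
    exact (D.of_layerEquiv E z).symm
  · intro h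
    exact D.toSystem.of_injective E ((D.of_layerEquiv E z).trans h)

omit [NumberField F] in
/-- **Equivariance**: `layerEquiv ([σ] • z) = σ|_E • layerEquiv z`. [cite: Harari2020, §13.1] -/
theorem layerEquiv_ρ_mk (E : GalLayer F) (σ : absoluteGaloisGroup F) (z : (D.layerRep E).V) :
    D.layerEquiv E ((D.layerRep E).ρ (QuotientGroup.mk σ) z) = D.ρ E (E.restrictHom σ) (D.layerEquiv E z) := by
  rw [layerEquiv_eq_iff, coe_layerRep_ρ_mk, ← D.of_layerEquiv E z, GalLayerSystem.rep_of]

/-- **`layerEquiv` intertwines the `Γ_F ⧸ U_E`-action on `(lim S)^{U_E}` with the `Gal(E/F)`-action on `D.obj E` along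
`quotEquiv`.** [cite: Harari2020, §13.1] -/
theorem layerEquiv_comm (E : GalLayer F)
    (g : absoluteGaloisGroup F ⧸ (E.openNormalSubgroup : Subgroup (absoluteGaloisGroup F))) :
    (D.layerEquiv E).toLinearMap ∘ₗ (D.layerRep E).ρ g = (D.obj E).ρ (E.quotEquiv g) ∘ₗ (D.layerEquiv E).toLinearMap := by
  induction g using QuotientGroup.induction_on with
  | H σ =>
    refine LinearMap.ext fun z => ?_
    change D.layerEquiv E ((D.layerRep E).ρ (QuotientGroup.mk σ) z) =
      D.ρ E (E.quotEquiv (QuotientGroup.mk σ)) (D.layerEquiv E z)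
    rw [layerEquiv_ρ_mk, GalLayer.quotEquiv_mk_eq_restrictHom]

omit [NumberField F] in
/-- **The inclusion `(lim S)^{U_E} ⊆ (lim S)^{U_{E'}}` of door-c4's system is the base change `D.base h`** under the
`layerEquiv`s. [cite: Harari2020, §13.1] -/
theorem layerEquiv_invariantsStepIncl {E E' : GalLayer F} (h : E ≤ E') (z : (D.layerRep E).V) :
    D.layerEquiv E' ((DiscreteRep.invariantsStepIncl (E.openNormalSubgroup : Subgroup (absoluteGaloisGroup F))
        (E'.openNormalSubgroup : Subgroup (absoluteGaloisGroup F)) (GalLayer.coe_openNormalSubgroup_le h)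
        D.toSystem.toD).hom z) =
      D.base h (D.layerEquiv E z) := by
  rw [layerEquiv_eq_iff, DiscreteRep.invariantsStepIncl_hom_apply_coe]
  rw [GalLayerSystem.of_base]
  exact (D.of_layerEquiv E z).symm

/-- **The layers of `lim S` have the cohomology of the system:
`Hⁿ(Γ_F ⧸ U_E, (lim S)^{U_E}) ≅ Hⁿ(Gal(E/F), D.obj E)`** (Mathlib `groupCohomology.mapIso` along `quotEquiv`, `layerEquiv`).
[cite: SerreGaloisCohomology1997, I §2.2 Proposition 8] -/
def layerCohomologyIso (E : GalLayer F) (n : ℕ) :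
    groupCohomology (D.layerRep E) n ≅ groupCohomology (D.obj E) n :=
  groupCohomology.mapIso E.quotEquiv (D.layerEquiv E) (D.layerEquiv_comm E) n

/-! ## §6. The inflations of the system and door-c4's transitions -/

omit [NumberField F] in
/-- **The base change `D.obj E → D.obj E'` as a morphism `Res_{res} (D.obj E) ⟶ D.obj E'` of `Gal(E'/F)`-modules**
(`E ≤ E'`; equivariance from `base_ρ` and the surjectivity of `σ ↦ σ|_{E'}`).
[cite: CasselsFrohlichANT1967, Ch. VII §11.1] -/
def baseRepHom {E E' : GalLayer F} (h : E ≤ E') : Rep.res (GalLayer.resHom h) (D.obj E) ⟶ D.obj E' :=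
  Rep.ofHom ⟨(D.base h).toIntLinearMap, fun τ => LinearMap.ext fun x => by
    obtain ⟨σ, rfl⟩ := E'.restrictHom_surjective τ
    change D.base h (D.ρ E (GalLayer.resHom h (E'.restrictHom σ)) x) = D.ρ E' (E'.restrictHom σ) (D.base h x)
    rw [GalLayer.resHom_restrictHom, D.base_ρ]⟩

omit [NumberField F] in
/-- Formula: `baseRepHom` is `D.base` on vectors. [cite: CasselsFrohlichANT1967, Ch. VII §11.1] -/
theorem baseRepHom_hom_apply {E E' : GalLayer F} (h : E ≤ E') (x : D.V E) :
    (D.baseRepHom h).hom x = D.base h x := rfl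

omit [NumberField F] in
/-- **The inflation `Hⁿ(Gal(E/F), D.obj E) → Hⁿ(Gal(E'/F), D.obj E')` of the system** (`E ≤ E'`; Mathlib
`groupCohomology.map res (D.base h)`; for the idèle class layers this is the cell's `classInf F E E' n`).
[cite: CasselsFrohlichANT1967, Ch. VII §11.1] -/
def inf {E E' : GalLayer F} (h : E ≤ E') (n : ℕ) : groupCohomology (D.obj E) n ⟶ groupCohomology (D.obj E') n :=
  groupCohomology.map (GalLayer.resHom h) (D.baseRepHom h) n

omit [NumberField F] in
/-- **At `E = E` the inflation is the identity** (`res = id`, `D.base = id` there: `resHom_self`, `base_self`).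
[cite: CasselsFrohlichANT1967, Ch. VII §11.1] -/
theorem inf_self {E : GalLayer F} (h : E ≤ E) (n : ℕ) : D.inf h n = 𝟙 _ := by
  -- at the level of inhomogeneous cochains (avoids retyping `𝟙` along `Rep.res (MonoidHom.id _)`)
  have hc : cochainsMap (GalLayer.resHom h) (D.baseRepHom h) = 𝟙 (inhomogeneousCochains (D.obj E)) := by
    refine HomologicalComplex.hom_ext _ _ fun i => ?_
    rw [cochainsMap_f, HomologicalComplex.id_f]
    refine ModuleCat.hom_ext (LinearMap.ext fun x => funext fun g => ?_)
    change D.base h (x ((GalLayer.resHom h : _ → _) ∘ g)) = x g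
    rw [show (GalLayer.resHom h : _ → _) ∘ g = g from funext fun j => GalLayer.resHom_self h (g j)]
    exact D.toSystem.base_self h (x g)
  change HomologicalComplex.homologyMap (cochainsMap (GalLayer.resHom h) (D.baseRepHom h)) n = _
  rw [hc, HomologicalComplex.homologyMap_id]
  rfl

/-- **`Hⁿ(quotMap, incl) ≫ iso_{E'} = iso_E ≫ D.inf h n` for all `E ≤ E'`**: door-c4's transition between the layers
`(lim S)^{U_E} ⊆ (lim S)^{U_{E'}}` IS the inflation of the system (both are `groupCohomology.map` along the same
homomorphism `Gal(E'/F) → Γ_F ⧸ U_E`, `σ|_{E'} ↦ [σ]`, with the same underlying map `[x] ↦ D.base h x`).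
[cite: SerreGaloisCohomology1997, I §2.2 Proposition 8][cite: CasselsFrohlichANT1967, Ch. VII §11.1] -/
theorem map_invariantsStepIncl_comp_layerCohomologyIso {E E' : GalLayer F} (h : E ≤ E') (n : ℕ) :
    groupCohomology.map
        (DiscreteRep.quotMap (E.openNormalSubgroup : Subgroup (absoluteGaloisGroup F))
          (E'.openNormalSubgroup : Subgroup (absoluteGaloisGroup F)) (GalLayer.coe_openNormalSubgroup_le h))
        (DiscreteRep.invariantsStepIncl (E.openNormalSubgroup : Subgroup (absoluteGaloisGroup F))
          (E'.openNormalSubgroup : Subgroup (absoluteGaloisGroup F)) (GalLayer.coe_openNormalSubgroup_le h)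
          D.toSystem.toD) n ≫ (D.layerCohomologyIso E' n).hom =
      (D.layerCohomologyIso E n).hom ≫ D.inf h n := by
  rw [layerCohomologyIso, layerCohomologyIso, groupCohomology.mapIso_hom, groupCohomology.mapIso_hom, inf,
    ← groupCohomology.map_comp, ← groupCohomology.map_comp]
  refine map_congr' (GalLayer.quotMap_comp_quotEquiv_symm_eq h) _ _ (fun z => ?_) n
  change D.layerEquiv E' ((DiscreteRep.invariantsStepIncl (E.openNormalSubgroup : Subgroup (absoluteGaloisGroup F))
      (E'.openNormalSubgroup : Subgroup (absoluteGaloisGroup F)) (GalLayer.coe_openNormalSubgroup_le h)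
      D.toSystem.toD).hom z) =
    (D.baseRepHom h).hom (D.layerEquiv E z)
  rw [layerEquiv_invariantsStepIncl, baseRepHom_hom_apply]

end GalLayerData

end Literature.NumberTheory.GaloisRepresentations

end
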